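import Mathlib
import HarnessLib
import Summits.CriticalPhenomena.CardyFormulaZ2.Theses.CardySelfDualSegment
import Literature.Probability.Percolation.CornerPercolation
import Literature.Probability.RandomPlanarGeometry.ShearModulusAnalytic
import Summits.CriticalPhenomena.CardyFormulaZ2.Theorems.CardySelfDualSegmentSegmentOpenReduction
import Summits.CriticalPhenomena.CardyFormulaZ2.Theorems.CardySelfDualSegmentSegmentOpenStubShearCrossRatioAnalytic

/-!
# Crux `SegmentOpen` (stmt-CriticalPhenomena-5471), line `Sketch` — given S4, the crux IS S6

With S7 (`stub_shearCrossRatioAnalytic` = `ShearCrossRatioAnalytic`, Dirichlet-principle route) now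
LANDED, the kernel-checked reduction `segmentOpen_of_uniformComplexBound_of_noIsolatedGoodPoint`
(S4 → S6 → S7 → `SegmentOpen`) sharpens to an EQUIVALENCE: assuming only the non-perturbative
input S4 (`stub_uniformComplexBound`: uniform complex bound of the crossing polynomials), the
route's `SegmentOpen` (`UniformMarginality → IsOpen G`) holds IF AND ONLY IF under
UniformMarginality no point of the good set `G` is isolated in `G` (the statement of the research
stub S6 `stub_noIsolatedGoodPoint`).  `→`: an open subset of the segment `[0,1]` has no isolated
points (`𝓝[≠] t` is non-trivial in `unitInterval`); `←`: the landed reduction fed with the landed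
S7.  Census statement for the planners: line `Sketch` has no slack left — modulo S4 the crux is
exactly S6 (perturbative linear universality at a Cardy point).
-/

noncomputable section

namespace Summit.CriticalPhenomena.CardyFormulaZ2.Theorems

open Literature.Probability Literature.Barriers.CriticalPhenomena
open Literature.Probability.RandomPlanarGeometry (ConformalRectangle ConformalEquiv MarkedDomain)
open Filter Set Topology

/-- In `unitInterval` every point of an open set is an accumulation point of it (the segment has
no isolated points). -/
theorem accPt_principal_of_isOpen_unitInterval {G : Set unitInterval} (hG : IsOpen G)
    {t : unitInterval} (ht : t ∈ G) : AccPt t (𝓟 G) := by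
  rw [accPt_iff_frequently]
  have hev : ∀ᶠ y in 𝓝[≠] t, y ∈ G := nhdsWithin_le_nhds (hG.mem_nhds ht)
  have hfr : ∃ᶠ y in 𝓝[≠] t, y ∈ G := hev.frequently
  exact (frequently_nhdsWithin_iff.1 hfr).mono fun y hy => by
    simp only [mem_compl_iff, mem_singleton_iff] at hy; tauto

/-- **Given S4, the crux `SegmentOpen` is EQUIVALENT to S6.**  Assuming the uniform complex
bound S4 of the crossing polynomials (hypothesis, verbatim the registered stub
`stub_uniformComplexBound`; NOT claimed), the route's `SegmentOpen` holds iff, under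
UniformMarginality, every point of the good set `G = {t | ∃ α, 0 < im α ∧ CardyMod t α}` is an
accumulation point of `G` (verbatim the statement of the research stub `stub_noIsolatedGoodPoint`).
`←` is `segmentOpen_of_uniformComplexBound_of_noIsolatedGoodPoint` (S1, S2', S5' landed) with the
LANDED S7 `stub_shearCrossRatioAnalytic`; `→` because open subsets of `[0,1]` have no isolated
points. -/
theorem stub_segmentOpen_iff_noIsolatedGoodPoint :
    (∀ t₀ : unitInterval, ∃ r > 0, ∀ R : ConformalRectangle, ∃ C : ℝ, ∀ δ : ℝ, 0 < δ →
      ∀ p : Polynomial ℝ,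
        (∀ t : unitInterval, Percolation.cornerCrossingProb t R δ = p.eval (t : ℝ)) →
        ∀ z ∈ Metric.ball ((t₀ : ℝ) : ℂ) r, ‖(p.map (algebraMap ℝ ℂ)).eval z‖ ≤ C) →
    (Summit.CriticalPhenomena.CardyFormulaZ2.Theses.CardySelfDualSegment.SegmentOpen ↔
      ((∀ (t₀ : unitInterval) (R : ConformalRectangle) (ε : ℝ), 0 < ε → ∃ η > 0,
          ∀ t : unitInterval, dist t t₀ < η → ∀ δ : ℝ, 0 < δ →
            |Percolation.cornerCrossingProb t R δ - Percolation.cornerCrossingProb t₀ R δ| < ε) →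
        ∀ t₀ ∈ {t : unitInterval | ∃ α : ℂ, 0 < α.im ∧
            ∀ (R R' : ConformalRectangle)
              (φ : ConformalEquiv UpperHalfPlane.upperHalfPlaneSet R.carrier) (x : Fin 4 → ℝ),
              R.carrier = moduliShear α '' R'.carrier → (∀ i, R.pt i = moduliShear α (R'.pt i)) →
              R.IsUniformizing φ x →
              Tendsto (Percolation.cornerCrossingProb t R') (𝓝[>] 0)
                (𝓝 (RandomPlanarGeometry.cardyFunction (RandomPlanarGeometry.crossRatio x)))},
          AccPt t₀ (𝓟 {t : unitInterval | ∃ α : ℂ, 0 < α.im ∧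
            ∀ (R R' : ConformalRectangle)
              (φ : ConformalEquiv UpperHalfPlane.upperHalfPlaneSet R.carrier) (x : Fin 4 → ℝ),
              R.carrier = moduliShear α '' R'.carrier → (∀ i, R.pt i = moduliShear α (R'.pt i)) →
              R.IsUniformizing φ x →
              Tendsto (Percolation.cornerCrossingProb t R') (𝓝[>] 0)
                (𝓝 (RandomPlanarGeometry.cardyFunction (RandomPlanarGeometry.crossRatio x)))}))) := by
  intro h4
  constructor
  · intro hOpen hUM t₀ ht₀
    exact accPt_principal_of_isOpen_unitInterval (hOpen hUM) ht₀
  · intro h6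
    exact segmentOpen_of_uniformComplexBound_of_noIsolatedGoodPoint h4 h6
      stub_shearCrossRatioAnalytic

end Summit.CriticalPhenomena.CardyFormulaZ2.Theorems
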